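import Literature.NumberTheory.EllipticCurves.MordellCurvePhiDescentHom
import Literature.NumberTheory.EllipticCurves.ThreeIsogeny
import Mathlib.Algebra.CubicDiscriminant
import HarnessLib

/-!
# The `3`-descent map `(x, y) ↦ y − (mx + s)` on `y² = x³ + (mx + s)²` is a homomorphism to `F*/F*³`
# (Cohen–Pazuki, *Elementary 3-descent with a 3-isogeny*, Definition 1.3 and Proposition 1.4 (2), case `D = 1`)

Topic `NumberTheory/EllipticCurves`. Companion of the tree's `MordellCurvePhiDescentHom`
(`MordellDescent.cubicDescentClass_add`: the case `m = 0`, i.e. `j = 0`, written there for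
`Y² = X³ + B²` with the function `Y + B`) and of `ThreeIsogeny` (Vélu's `3`-isogeny of the same
model `threeTorsionModel m s = [0, m², 0, 2ms, s²]`). Everything here is proved; no named facts,
no new curves: the target group is the tree's `MordellDescent.CubeUnits F = Fˣ/Fˣ³` with its total
class map `MordellDescent.cubeClass`.

Source [CohenPazuki2009] (held: `paper:arxiv-0903.4963`, §1), VERBATIM. The curve is «given by an
equation `y² = x³ + D(ax + b)²` … The `3`-torsion point `T` is equal to `(0, b√D)`, so is rational if
and only if `D ∈ ℚ*²`» (before Lemma 1.2). **Definition 1.3.** «The `3`-descent map `α` is a map from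
`E(ℚ)` to the subgroup `G₃` of classes of elements of `K*/K*³` whose norm is a cube (or `G₃ = ℚ*/ℚ*³`
if `D = 1`) defined by `α(O) = 1`, `α((0, b)) = 1/(2b)` when `D = 1`, and in general by
`α((x, y)) = y − (ax + b)√D`.» **Proposition 1.4 (2).** «The map `α` is a group homomorphism from
`E(ℚ)` to `G₃`, and `Ker(α) = Im(φ̂)`.»

## What is formalized (the case `D = 1`, over an arbitrary field `F` with `2 ≠ 0`)

For `W = threeTorsionModel m s : y² = x³ + m²x² + 2msx + s² = x³ + (mx + s)²` (Cohen–Pazuki's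
`(a, b) = (m, s)`, `D = 1`; rational `3`-torsion point `T = (0, s)`, Vélu partner
`threeIsogenyCodomain m s` in `ThreeIsogeny`):

* `ThreeTorsionDescent.descent m s : W(F) → F` — the map `α` of Definition 1.3 read in `F`:
  `O ↦ 1`, `(x, y) ↦ y − (mx + s)`, and `T = (0, s) ↦ (2s)²` (the class of Cohen–Pazuki's `1/(2s)`:
  `descentClass_T_eq`, since `(2s)² · (2s) = (2s)³`); `descentClass m s = cubeClass ∘ descent m s`.
* the identities behind it: `(y − mx − s)(y + mx + s) = x³` (`mul_conj_eq_cube`), the points with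
  `x = 0` are `±T`, and **the chord identity** `descent_prod_eq_cube`: for `P₁ = (x₁, y₁)`,
  `P₂ = (x₂, y₂)` not opposite, `ℓ` the slope of the chord (tangent) and `R = (x₃, Y_R)` the third
  intersection, `∏ (yᵢ − m xᵢ − s) = (y₁ − s − ℓ x₁)³` (Vieta for Mathlib's `addPolynomial_slope`:
  along the line the function is `(ℓ − m)X + μ` and `∏ ((ℓ − m)xᵢ + μ) = μ³`); the same for the
  conjugate function `y + mx + s` (`conj_prod_eq_cube`).
* **`descentClass_add`** — Proposition 1.4 (2), first half, for `D = 1`: `[α(P + Q)] = [α(P)][α(Q)]`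
  in `Fˣ/Fˣ³` (`2 ≠ 0`, `s ≠ 0`); whence `descentClass_neg_mul`, `descentClass_sub_eq_one` and the
  bundled homomorphism `descentHom m s : W(F) →+ Additive (Fˣ/Fˣ³)`.

The second half of Prop. 1.4 (2) (`Ker α = Im φ̂`, needing the dual isogeny) and the case `D ≠ 1`
(values in `K*/K*³`, `K = F(√D)`; over `K` it is the present statement for `(m, s√D)`) are NOT in
this file. Use: the `3`-isogeny descent for the rank of a curve with a rational `3`-torsion point
and `j ≠ 0` (the tree's `MordellT` files do `j = 0`), e.g. the door at `3` for non-CM curves of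
route ShaPrimaryTransfer.

## References

* [CohenPazuki2009] H. Cohen, F. Pazuki, *Elementary 3-descent with a 3-isogeny*, Acta Arith. 140
  (2009) 369–404: Definition 1.3, Proposition 1.4.
* [Top1993DescentByThreeIsogeny] J. Top, *Descent by 3-isogeny and 3-rank of quadratic fields*,
  in: Advances in Number Theory (Kingston 1991), OUP 1993, 303–317, §3.
* [SilvermanAEC2009] J. H. Silverman, *The Arithmetic of Elliptic Curves*, 2nd ed., X.4.9 (the
  `2`-isogeny analogue), Exercise 10.1.
* Templates in the tree: `MordellCurvePhiDescentHom` (`m = 0`), `ThreeIsogeny` (the model).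

## Design

Theorems and two `def`s (the map and its class), in the new namespace
`Literature.NumberTheory.EllipticCurves.ThreeTorsionDescent`; the curve enters through the
hypothesis `hW : W = threeTorsionModel m s` (as `hW : W = mordellCurve (B ^ 2)` in the template), so
that the statements apply verbatim to base changes (`map_threeTorsionModel`). `open scoped Classical`
supplies the `DecidableEq F` of Mathlib's chord–tangent law.
-/

noncomputable section

open scoped Classical

open WeierstrassCurve Polynomial

universe u

namespace Literature.NumberTheory.EllipticCurves

namespace ThreeTorsionDescent

open MordellDescent

variable {F : Type u} [Field F]

/-! ## The curve `y² = x³ + (mx + s)²`: the two conjugate functions `y ∓ (mx + s)` -/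

section Curve

variable {W : WeierstrassCurve F} {m s : F}

/-- The equation of `threeTorsionModel m s`: `y² = x³ + m²x² + 2msx + s² = x³ + (mx + s)²`.
[cite: CohenPazuki2009, §1 (the model y² = x³ + D(ax + b)², D = 1)] -/
theorem equation_iff_of_eq (hW : W = threeTorsionModel m s) (x y : F) :
    W.toAffine.Equation x y ↔ y ^ 2 = x ^ 3 + m ^ 2 * x ^ 2 + 2 * m * s * x + s ^ 2 := by
  subst hW
  rw [Affine.equation_iff, threeTorsionModel_a₁, threeTorsionModel_a₂, threeTorsionModel_a₃,
    threeTorsionModel_a₄, threeTorsionModel_a₆]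
  constructor <;> intro e <;> linear_combination e

/-- Negation on `threeTorsionModel m s` is `(x, y) ↦ (x, −y)`. [cite: CohenPazuki2009, §1 (the model y² = x³ + D(ax + b)²)] -/
theorem negY_of_eq (hW : W = threeTorsionModel m s) (x y : F) : W.toAffine.negY x y = -y := by
  subst hW; simp [Affine.negY]

/-- On the curve: `(y − mx − s)(y + mx + s) = x³`. [cite: CohenPazuki2009, §1 (proof of Prop. 2.2)] -/
theorem mul_conj_eq_cube (hW : W = threeTorsionModel m s) {x y : F} (h : W.toAffine.Equation x y) :
    (y - m * x - s) * (y + m * x + s) = x ^ 3 := by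
  rw [equation_iff_of_eq hW] at h; linear_combination h

/-- If `y − mx − s = 0` or `y + mx + s = 0` at a point of the curve then `x = 0` (the functions
`y ∓ (mx + s)` vanish only at `∓T`). [cite: CohenPazuki2009, §1 (T = (0, b√D)) and Definition 1.3] -/
theorem x_eq_zero_of (hW : W = threeTorsionModel m s) {x y : F} (h : W.toAffine.Equation x y)
    (hy : y - m * x - s = 0 ∨ y + m * x + s = 0) : x = 0 := by
  have h3 : x ^ 3 = 0 := by
    rw [← mul_conj_eq_cube hW h]
    rcases hy with h0 | h0 <;> rw [h0] <;> ring
  exact pow_eq_zero_iff three_ne_zero |>.mp h3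

/-- A point of the curve with `x = 0` has `y = s` or `y = −s`. [cite: CohenPazuki2009, §1 (T = (0, b))] -/
theorem y_eq_or_of_x_eq_zero (hW : W = threeTorsionModel m s) {x y : F} (h : W.toAffine.Equation x y)
    (hx : x = 0) : y = s ∨ y = -s := by
  have := mul_conj_eq_cube hW h
  rw [hx, zero_pow three_ne_zero, mul_eq_zero] at this
  rcases this with h1 | h1
  · exact Or.inl (by linear_combination h1)
  · exact Or.inr (by linear_combination h1)

/-- `y − mx − s = 0` on the curve iff `(x, y) = (0, s) = T` — the one point where Definition 1.3
assigns the special value `1/(2b)`. [cite: CohenPazuki2009, Definition 1.3] -/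
theorem sub_eq_zero_iff (hW : W = threeTorsionModel m s) {x y : F} (h : W.toAffine.Equation x y) :
    y - m * x - s = 0 ↔ x = 0 ∧ y = s := by
  constructor
  · intro h0
    have hx := x_eq_zero_of hW h (Or.inl h0)
    exact ⟨hx, by rw [hx] at h0; linear_combination h0⟩
  · rintro ⟨hx, hy⟩; rw [hx, hy]; ring

/-- `y + mx + s = 0` on the curve iff `(x, y) = (0, −s) = −T`. [cite: CohenPazuki2009, §1 (T = (0, b√D))] -/
theorem add_eq_zero_iff (hW : W = threeTorsionModel m s) {x y : F} (h : W.toAffine.Equation x y) :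
    y + m * x + s = 0 ↔ x = 0 ∧ y = -s := by
  constructor
  · intro h0
    have hx := x_eq_zero_of hW h (Or.inr h0)
    exact ⟨hx, by rw [hx] at h0; linear_combination h0⟩
  · rintro ⟨hx, hy⟩; rw [hx, hy]; ring

/-- **The chord identity** for `y − (mx + s)`. For `P₁ = (x₁, y₁)`, `P₂ = (x₂, y₂)` on
`y² = x³ + (mx + s)²`, not opposite, `ℓ` the slope of the chord (tangent) through them and
`Y_R = ℓ(x₃ − x₁) + y₁` (Mathlib's `negAddY`) the ordinate of the third intersection `(x₃, Y_R)`: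
`(y₁ − mx₁ − s)(y₂ − mx₂ − s)(Y_R − mx₃ − s) = (y₁ − s − ℓx₁)³` — along the line the function is
`(ℓ − m)X + μ`, `μ = y₁ − s − ℓx₁`, and by Vieta for `addPolynomial_slope`
`∏ ((ℓ − m)xᵢ + μ) = (ℓ − m)³e₃ + (ℓ − m)²μe₂ + (ℓ − m)μ²e₁ + μ³ = μ³`.
[cite: CohenPazuki2009, Prop. 1.4 (2) (proof via Prop. 2.2)] -/
theorem descent_prod_eq_cube (hW : W = threeTorsionModel m s) {x₁ x₂ y₁ y₂ : F}
    (h₁ : W.toAffine.Equation x₁ y₁) (h₂ : W.toAffine.Equation x₂ y₂)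
    (hxy : ¬(x₁ = x₂ ∧ y₁ = W.toAffine.negY x₂ y₂)) :
    (y₁ - m * x₁ - s) * (y₂ - m * x₂ - s) *
        (W.toAffine.negAddY x₁ x₂ y₁ (W.toAffine.slope x₁ x₂ y₁ y₂) -
          m * W.toAffine.addX x₁ x₂ (W.toAffine.slope x₁ x₂ y₁ y₂) - s) =
      (y₁ - s - W.toAffine.slope x₁ x₂ y₁ y₂ * x₁) ^ 3 := by
  have hline := y₂_eq_line h₁ h₂ hxy
  subst hW
  -- Vieta from `addPolynomial_slope`
  have hpoly := Affine.addPolynomial_slope h₁ h₂ hxy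
  rw [Affine.addPolynomial_eq, Cubic.prod_X_sub_C_eq, neg_inj, Cubic.toPoly_injective] at hpoly
  simp only [threeTorsionModel_a₁, threeTorsionModel_a₂, threeTorsionModel_a₃,
    threeTorsionModel_a₄, threeTorsionModel_a₆, Cubic.mk.injEq] at hpoly
  obtain ⟨-, he₁, he₂, he₃⟩ := hpoly
  set ℓ := (threeTorsionModel m s).toAffine.slope x₁ x₂ y₁ y₂ with hℓ
  set x₃ := (threeTorsionModel m s).toAffine.addX x₁ x₂ ℓ with hx₃
  have hnY : (threeTorsionModel m s).toAffine.negAddY x₁ x₂ y₁ ℓ = ℓ * (x₃ - x₁) + y₁ := rfl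
  rw [hnY, hline]
  linear_combination ((ℓ - m) * (y₁ - s - ℓ * x₁) ^ 2) * he₁ +
    (-((ℓ - m) ^ 2 * (y₁ - s - ℓ * x₁))) * he₂ + (ℓ - m) ^ 3 * he₃

/-- **The chord identity** for the conjugate function `y + (mx + s)`:
`(y₁ + mx₁ + s)(y₂ + mx₂ + s)(Y_R + mx₃ + s) = (y₁ + s − ℓx₁)³`. [cite: CohenPazuki2009, Prop. 1.4 (2) (proof via Prop. 2.2)] -/
theorem conj_prod_eq_cube (hW : W = threeTorsionModel m s) {x₁ x₂ y₁ y₂ : F}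
    (h₁ : W.toAffine.Equation x₁ y₁) (h₂ : W.toAffine.Equation x₂ y₂)
    (hxy : ¬(x₁ = x₂ ∧ y₁ = W.toAffine.negY x₂ y₂)) :
    (y₁ + m * x₁ + s) * (y₂ + m * x₂ + s) *
        (W.toAffine.negAddY x₁ x₂ y₁ (W.toAffine.slope x₁ x₂ y₁ y₂) +
          m * W.toAffine.addX x₁ x₂ (W.toAffine.slope x₁ x₂ y₁ y₂) + s) =
      (y₁ + s - W.toAffine.slope x₁ x₂ y₁ y₂ * x₁) ^ 3 := by
  -- `threeTorsionModel m s = threeTorsionModel (-m) (-s)` as curves; apply the previous identity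
  have hW' : W = threeTorsionModel (-m) (-s) := by
    rw [hW]; simp only [threeTorsionModel]; ring_nf
  have h := descent_prod_eq_cube hW' h₁ h₂ hxy
  have e1 : ∀ x y : F, y - -m * x - -s = y + m * x + s := fun x y => by ring
  have e2 : y₁ - -s - W.toAffine.slope x₁ x₂ y₁ y₂ * x₁ = y₁ + s - W.toAffine.slope x₁ x₂ y₁ y₂ * x₁ := by
    ring
  rw [e1, e1, e2] at h
  rw [← h]
  ring

end Curve

/-! ## The descent map `α` and its multiplicativity -/

section Descent

variable {W : WeierstrassCurve F} {m s : F}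

variable (W) in
/-- **Cohen–Pazuki's `3`-descent map `α` for `D = 1`**, read in `F` (values modulo `F*³`), on the
points of `W = threeTorsionModel m s : y² = x³ + (mx + s)²`: `O ↦ 1`, `(x, y) ↦ y − (mx + s)` when
this is non-zero, and `T = (0, s)` (the only point where it vanishes) `↦ (2s)²`, the class of the
printed value `1/(2s)` (`(2s)² · 2s = (2s)³`). [cite: CohenPazuki2009, Definition 1.3] -/
def descent (m s : F) : W.toAffine.Point → F
  | .zero => 1
  | .some x y _ => if y - m * x - s = 0 then (2 * s) ^ 2 else y - m * x - s

/-- `α(O) = 1`. [cite: CohenPazuki2009, Definition 1.3] -/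
@[simp] theorem descent_zero (m s : F) : descent W m s 0 = 1 := rfl

/-- `α` at an affine point. [cite: CohenPazuki2009, Definition 1.3] -/
theorem descent_some (m s : F) {x y : F} (h : W.toAffine.Nonsingular x y) :
    descent W m s (.some x y h) = if y - m * x - s = 0 then (2 * s) ^ 2 else y - m * x - s := rfl

/-- `α(x, y) = y − (mx + s)` when this is non-zero. [cite: CohenPazuki2009, Definition 1.3] -/
theorem descent_some_of_ne (m s : F) {x y : F} (h : W.toAffine.Nonsingular x y)
    (hy : y - m * x - s ≠ 0) : descent W m s (.some x y h) = y - m * x - s := by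
  rw [descent_some, if_neg hy]

/-- `α(T) = (2s)²` at the point where `y − (mx + s) = 0`. [cite: CohenPazuki2009, Definition 1.3] -/
theorem descent_some_of_eq (m s : F) {x y : F} (h : W.toAffine.Nonsingular x y)
    (hy : y - m * x - s = 0) : descent W m s (.some x y h) = (2 * s) ^ 2 := by
  rw [descent_some, if_pos hy]

variable (W) in
/-- The descent class `[α(P)] ∈ Fˣ/Fˣ³`. [cite: CohenPazuki2009, Definition 1.3] -/
def descentClass (m s : F) (P : W.toAffine.Point) : CubeUnits F :=
  cubeClass (descent W m s P)

/-- `[α(O)] = 1`. [cite: CohenPazuki2009, Definition 1.3] -/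
@[simp] theorem descentClass_zero (m s : F) : descentClass W m s 0 = 1 := by
  rw [descentClass, descent_zero, cubeClass_one]

/-- `α` never vanishes (`2s ≠ 0`): its values are units, read modulo cubes. [cite: CohenPazuki2009, Definition 1.3] -/
theorem descent_ne_zero (h2s : (2 : F) * s ≠ 0) (P : W.toAffine.Point) : descent W m s P ≠ 0 := by
  rcases P with _ | ⟨x, y, h⟩
  · exact one_ne_zero
  · rw [descent_some]
    split_ifs with hy
    · exact pow_ne_zero 2 h2s
    · exact hy

/-- The printed value at `T`: `[(2s)²] = [1/(2s)]` in `Fˣ/Fˣ³`. [cite: CohenPazuki2009, Definition 1.3 (α((0,b)) = 1/(2b))] -/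
theorem cubeClass_sq_eq_cubeClass_inv (h2s : (2 : F) * s ≠ 0) :
    cubeClass ((2 * s) ^ 2) = cubeClass (1 / (2 * s)) := by
  rw [cubeClass_eq_cubeClass_iff (pow_ne_zero 2 h2s) (one_div_ne_zero h2s)]
  exact ⟨2 * s, h2s, by field_simp⟩

/-- **Proposition 1.4 (2) of Cohen–Pazuki for `D = 1`: the `3`-descent map is a homomorphism
`E(F) → Fˣ/Fˣ³`** (`2 ≠ 0`, `s ≠ 0`): `[α(P + Q)] = [α(P)][α(Q)]`. Case analysis over the
chord–tangent law; in each case an explicit `w` with `α(P) α(Q) = α(P + Q) w³` is produced from the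
chord identities for `y ∓ (mx + s)` (`descent_prod_eq_cube`, `conj_prod_eq_cube`) and
`(y − mx − s)(y + mx + s) = x³` at `P`, `Q` and at the third point of the chord.
[cite: CohenPazuki2009, Proposition 1.4 (2)] -/
theorem descentClass_add (hW : W = threeTorsionModel m s) (h2 : (2 : F) ≠ 0)
    (hs : s ≠ 0) (P Q : W.toAffine.Point) :
    descentClass W m s (P + Q) = descentClass W m s P * descentClass W m s Q := by
  have h2s : (2 : F) * s ≠ 0 := mul_ne_zero h2 hs
  have h2s2 : ((2 : F) * s) ^ 2 ≠ 0 := pow_ne_zero 2 h2s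
  have hss : s ≠ -s := fun h => h2s (by linear_combination h)
  have hnegY : ∀ x y : F, W.toAffine.negY x y = -y := negY_of_eq hW
  have ha₁ : W.toAffine.a₁ = 0 := by rw [hW]; rfl
  have ha₂ : W.toAffine.a₂ = m ^ 2 := by rw [hW]; rfl
  have ha₄ : W.toAffine.a₄ = 2 * m * s := by rw [hW]; rfl
  rcases P with _ | ⟨x₁, y₁, h₁⟩
  · rw [← Affine.Point.zero_def, zero_add, descentClass_zero, CubeUnits.one_mul]
  rcases Q with _ | ⟨x₂, y₂, h₂⟩
  · rw [← Affine.Point.zero_def, add_zero, descentClass_zero, CubeUnits.mul_one]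
  have hc₁ := mul_conj_eq_cube hW h₁.left
  have hc₂ := mul_conj_eq_cube hW h₂.left
  simp only [descentClass]
  by_cases hopp : x₁ = x₂ ∧ y₁ = W.toAffine.negY x₂ y₂
  · /- `Q = −P`: `P + Q = O` -/
    rw [Affine.Point.add_of_Y_eq hopp.1 hopp.2, descent_zero, cubeClass_one]
    obtain ⟨hx, hy⟩ := hopp
    rw [hnegY] at hy
    rw [descent_some, descent_some]
    by_cases hf₁ : y₁ - m * x₁ - s = 0
    · -- `P = T`, `Q = −T`: `(2s)² · (−2s) = (−2s)³`
      obtain ⟨hx₁, hy₁⟩ := (sub_eq_zero_iff hW h₁.left).mp hf₁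
      have hx₂ : x₂ = 0 := hx.symm.trans hx₁
      have hy₂ : y₂ = -s := by linear_combination hy - hy₁
      have hf₂ : y₂ - m * x₂ - s ≠ 0 := by
        rw [hx₂, hy₂]; intro h; exact h2s (by linear_combination -h)
      rw [if_pos hf₁, if_neg hf₂, hx₂, hy₂, ← cubeClass_mul h2s2 (by
        rw [mul_zero, sub_zero]; intro h; exact h2s (by linear_combination -h)),
        show (2 * s) ^ 2 * (-s - m * 0 - s) = (-(2 * s)) ^ 3 by ring, cubeClass_pow_three]
    by_cases hf₂ : y₂ - m * x₂ - s = 0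
    · -- `P = −T`, `Q = T`
      obtain ⟨hx₂, hy₂⟩ := (sub_eq_zero_iff hW h₂.left).mp hf₂
      have hx₁ : x₁ = 0 := hx.trans hx₂
      have hy₁ : y₁ = -s := by linear_combination hy - hy₂
      rw [if_neg hf₁, if_pos hf₂, hx₁, hy₁, ← cubeClass_mul (by
        rw [mul_zero, sub_zero]; intro h; exact h2s (by linear_combination -h)) h2s2,
        show (-s - m * 0 - s) * (2 * s) ^ 2 = (-(2 * s)) ^ 3 by ring, cubeClass_pow_three]
    · -- generic opposite points: `(y₁ − mx₁ − s)(−y₁ − mx₁ − s) = (−x₁)³`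
      rw [if_neg hf₁, if_neg hf₂, ← cubeClass_mul hf₁ hf₂,
        show (y₁ - m * x₁ - s) * (y₂ - m * x₂ - s) = (-x₁) ^ 3 by
          rw [← hx]; linear_combination (y₁ - m * x₁ - s) * hy - hc₁, cubeClass_pow_three]
  · /- the chord (tangent) through `P`, `Q`, and its third point `R = (x₃, Y)` -/
    have h4 : (4 : F) ≠ 0 := by rw [show (4 : F) = 2 * 2 by norm_num]; exact mul_ne_zero h2 h2
    have hline := y₂_eq_line h₁.left h₂.left hopp
    have hR := Affine.equation_negAdd h₁.left h₂.left hopp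
    have Cp := descent_prod_eq_cube hW h₁.left h₂.left hopp
    have Cm := conj_prod_eq_cube hW h₁.left h₂.left hopp
    have hYd : W.toAffine.addY x₁ x₂ y₁ (W.toAffine.slope x₁ x₂ y₁ y₂) =
        -(W.toAffine.negAddY x₁ x₂ y₁ (W.toAffine.slope x₁ x₂ y₁ y₂)) := by
      rw [show W.toAffine.addY x₁ x₂ y₁ (W.toAffine.slope x₁ x₂ y₁ y₂) =
        W.toAffine.negY (W.toAffine.addX x₁ x₂ (W.toAffine.slope x₁ x₂ y₁ y₂))
          (W.toAffine.negAddY x₁ x₂ y₁ (W.toAffine.slope x₁ x₂ y₁ y₂)) from rfl, hnegY]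
    rw [Affine.Point.add_some hopp, descent_some, descent_some, descent_some, hYd]
    have hc₃ := mul_conj_eq_cube hW hR
    -- name the slope `ℓ`, the third point `(x₃, Y)`
    generalize hℓ : W.toAffine.slope x₁ x₂ y₁ y₂ = ℓ at hline hR Cp Cm hc₃ ⊢
    generalize hx₃ : W.toAffine.addX x₁ x₂ ℓ = x₃ at hR hc₃ Cp Cm ⊢
    generalize hYdef : W.toAffine.negAddY x₁ x₂ y₁ ℓ = Y at hR Cp Cm hc₃ ⊢
    -- `α(P + Q) = α(x₃, −Y)`: its function value is `−Y − m x₃ − s = −(Y + m x₃ + s)`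
    have eY : -Y - m * x₃ - s = -(Y + m * x₃ + s) := by ring
    rw [eY, neg_eq_zero]
    by_cases hf₁ : y₁ - m * x₁ - s = 0
    · obtain ⟨hx₁, hy₁⟩ := (sub_eq_zero_iff hW h₁.left).mp hf₁
      by_cases hf₂ : y₂ - m * x₂ - s = 0
      · /- `P = Q = T`: the tangent at `T` has slope `m`, third point `T`, `P + Q = −T` -/
        obtain ⟨hx₂, hy₂⟩ := (sub_eq_zero_iff hW h₂.left).mp hf₂
        have hy' : y₁ ≠ W.toAffine.negY x₂ y₂ := fun h => hopp ⟨hx₁.trans hx₂.symm, h⟩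
        have hℓm : ℓ = m := by
          rw [← hℓ, Affine.slope_of_Y_ne (hx₁.trans hx₂.symm) hy', hnegY, hx₁, hy₁, ha₁, ha₂, ha₄,
            div_eq_iff (by intro h; exact h2s (by linear_combination h))]
          ring
        have hx₃0 : x₃ = 0 := by
          rw [← hx₃, Affine.addX, hℓm, hx₁, hx₂, ha₁, ha₂]; ring
        have hYv : Y = s := by
          rw [← hYdef, Affine.negAddY, hx₃, hx₃0, hx₁, hy₁]; ring
        have hg : Y + m * x₃ + s ≠ 0 := by
          rw [hYv, hx₃0]; intro h; exact h2s (by linear_combination h)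
        rw [if_pos hf₁, if_pos hf₂, if_neg hg, hYv, hx₃0,
          show -(s + m * 0 + s) = -(2 * s) by ring, ← cubeClass_mul h2s2 h2s2,
          show (2 * s) ^ 2 * (2 * s) ^ 2 = -(2 * s) * (-(2 * s)) ^ 3 by ring,
          cubeClass_mul_pow_three (neg_ne_zero.mpr h2s) (neg_ne_zero.mpr h2s)]
      · /- `P = T`, `Q` generic: `(2s)² α(Q) = (−(Y + m x₃ + s)) (−x₂)³` -/
        have hx₂ : x₂ ≠ 0 := by
          intro hx₂
          rcases y_eq_or_of_x_eq_zero hW h₂.left hx₂ with h | h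
          · exact hf₂ (by rw [hx₂, h]; ring)
          · exact hopp ⟨hx₁.trans hx₂.symm, by rw [hnegY, h, hy₁, neg_neg]⟩
        -- `Cm` with `P = T`: `(2s)(y₂ + m x₂ + s)(Y + m x₃ + s) = (2s)³`
        have key0 : (y₂ + m * x₂ + s) * (Y + m * x₃ + s) = 4 * s ^ 2 := by
          have e : (2 * s) * ((y₂ + m * x₂ + s) * (Y + m * x₃ + s) - 4 * s ^ 2) = 0 := by
            rw [hy₁, hx₁] at Cm; linear_combination Cm
          exact sub_eq_zero.mp ((mul_eq_zero.mp e).resolve_left h2s)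
        have hg : Y + m * x₃ + s ≠ 0 := by
          intro h; rw [h, mul_zero] at key0
          exact hs (pow_eq_zero_iff two_ne_zero |>.mp ((mul_eq_zero.mp key0.symm).resolve_left h4))
        have key : (2 * s) ^ 2 * (y₂ - m * x₂ - s) = -(Y + m * x₃ + s) * (-x₂) ^ 3 := by
          rw [neg_pow, show ((-1 : F)) ^ 3 = -1 by norm_num, ← hc₂]
          linear_combination -(y₂ - m * x₂ - s) * key0
        rw [if_pos hf₁, if_neg hf₂, if_neg hg, ← cubeClass_mul h2s2 hf₂, key,
          cubeClass_mul_pow_three (neg_ne_zero.mpr hg) (neg_ne_zero.mpr hx₂)]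
    by_cases hf₂ : y₂ - m * x₂ - s = 0
    · /- `Q = T`, `P` generic: `α(P) (2s)² = (−(Y + m x₃ + s)) (−x₁)³` -/
      obtain ⟨hx₂, hy₂⟩ := (sub_eq_zero_iff hW h₂.left).mp hf₂
      have hx₁ : x₁ ≠ 0 := by
        intro hx₁
        rcases y_eq_or_of_x_eq_zero hW h₁.left hx₁ with h | h
        · exact hf₁ (by rw [hx₁, h]; ring)
        · exact hopp ⟨hx₁.trans hx₂.symm, by rw [hnegY, h, hy₂]⟩
      -- the line through `P` and `T = (0, s)`: `y₁ − ℓ x₁ = s`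
      have hν : y₁ - ℓ * x₁ = s := by rw [hx₂, hy₂] at hline; linear_combination -hline
      have key0 : (y₁ + m * x₁ + s) * (Y + m * x₃ + s) = 4 * s ^ 2 := by
        have hμ : y₁ + s - ℓ * x₁ = 2 * s := by linear_combination hν
        have e : (2 * s) * ((y₁ + m * x₁ + s) * (Y + m * x₃ + s) - 4 * s ^ 2) = 0 := by
          rw [hy₂, hx₂, hμ] at Cm
          linear_combination Cm
        exact sub_eq_zero.mp ((mul_eq_zero.mp e).resolve_left h2s)
      have hg : Y + m * x₃ + s ≠ 0 := by
        intro h; rw [h, mul_zero] at key0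
        exact hs (pow_eq_zero_iff two_ne_zero |>.mp ((mul_eq_zero.mp key0.symm).resolve_left h4))
      have key : (y₁ - m * x₁ - s) * (2 * s) ^ 2 = -(Y + m * x₃ + s) * (-x₁) ^ 3 := by
        rw [neg_pow, show ((-1 : F)) ^ 3 = -1 by norm_num, ← hc₁]
        linear_combination -(y₁ - m * x₁ - s) * key0
      rw [if_neg hf₁, if_pos hf₂, if_neg hg, ← cubeClass_mul hf₁ h2s2, key,
        cubeClass_mul_pow_three (neg_ne_zero.mpr hg) (neg_ne_zero.mpr hx₁)]
    · /- `P`, `Q` generic -/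
      rw [if_neg hf₁, if_neg hf₂]
      by_cases hgR : Y + m * x₃ + s = 0
      · /- `R = −T`, `P + Q = T`: `α(P) α(Q) (−2s) = μ³` -/
        obtain ⟨hx₃0, hYv⟩ := (add_eq_zero_iff hW hR).mp hgR
        rw [if_pos hgR, ← cubeClass_mul hf₁ hf₂]
        rw [hYv, hx₃0, show -s - m * 0 - s = -(2 * s) by ring] at Cp
        have hμ : y₁ - s - ℓ * x₁ ≠ 0 := by
          intro h0
          rw [h0, zero_pow three_ne_zero, mul_eq_zero, mul_eq_zero] at Cp
          rcases Cp with (h | h) | h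
          · exact hf₁ h
          · exact hf₂ h
          · exact h2s (by linear_combination -h)
        have key : (y₁ - m * x₁ - s) * (y₂ - m * x₂ - s) =
            (2 * s) ^ 2 * (-(y₁ - s - ℓ * x₁) / (2 * s)) ^ 3 := by
          rw [div_pow, mul_div_assoc', eq_div_iff (pow_ne_zero 3 h2s)]
          linear_combination -(2 * s) ^ 2 * Cp
        rw [key, cubeClass_mul_pow_three h2s2 (div_ne_zero (neg_ne_zero.mpr hμ) h2s)]
      · rw [if_neg hgR]
        by_cases hfR : Y - m * x₃ - s = 0
        · /- `R = T`, `P + Q = −T`: `(y₁ + mx₁ + s)(y₂ + mx₂ + s)(2s) = μ'³` and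
             `(yᵢ − mxᵢ − s)(yᵢ + mxᵢ + s) = xᵢ³` -/
          obtain ⟨hx₃0, hYv⟩ := (sub_eq_zero_iff hW hR).mp hfR
          rw [hYv, hx₃0, show s + m * 0 + s = 2 * s by ring] at Cm
          rw [hYv, hx₃0, show -(s + m * 0 + s) = -(2 * s) by ring]
          have hg₁ : y₁ + m * x₁ + s ≠ 0 := by
            intro h
            obtain ⟨hx, hy⟩ := (add_eq_zero_iff hW h₁.left).mp h
            -- then `Cp` reads `α(P) α(Q) · 0 = (−2s − 0)³`
            rw [hYv, hx₃0, hx, hy] at Cp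
            have : (-(2 * s)) ^ 3 = 0 := by linear_combination -Cp
            exact h2s (neg_eq_zero.mp (pow_eq_zero_iff three_ne_zero |>.mp this))
          have hg₂ : y₂ + m * x₂ + s ≠ 0 := by
            intro h
            obtain ⟨hx, hy⟩ := (add_eq_zero_iff hW h₂.left).mp h
            have hν : y₁ - ℓ * x₁ = -s := by
              rw [hx, hy] at hline; linear_combination -hline
            have : (-(2 * s)) ^ 3 = 0 := by
              have hμ : y₁ - s - ℓ * x₁ = -(2 * s) := by linear_combination hν
              rw [hYv, hx₃0, hμ] at Cp
              linear_combination -Cp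
            exact h2s (neg_eq_zero.mp (pow_eq_zero_iff three_ne_zero |>.mp this))
          have hμ : y₁ + s - ℓ * x₁ ≠ 0 := by
            intro h0
            rw [h0, zero_pow three_ne_zero, mul_eq_zero, mul_eq_zero] at Cm
            rcases Cm with (h | h) | h
            · exact hg₁ h
            · exact hg₂ h
            · exact h2s h
          have hx₁ : x₁ ≠ 0 := by
            intro hx
            have h3 : (y₁ - m * x₁ - s) * (y₁ + m * x₁ + s) = 0 := by rw [hc₁, hx]; ring
            rcases mul_eq_zero.mp h3 with h | h
            · exact hf₁ h
            · exact hg₁ h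
          have hx₂ : x₂ ≠ 0 := by
            intro hx
            have h3 : (y₂ - m * x₂ - s) * (y₂ + m * x₂ + s) = 0 := by rw [hc₂, hx]; ring
            rcases mul_eq_zero.mp h3 with h | h
            · exact hf₂ h
            · exact hg₂ h
          have key : (y₁ - m * x₁ - s) * (y₂ - m * x₂ - s) =
              -(2 * s) * (-(x₁ * x₂) / (y₁ + s - ℓ * x₁)) ^ 3 := by
            rw [div_pow, mul_div_assoc', eq_div_iff (pow_ne_zero 3 hμ)]
            linear_combination (-(y₁ - m * x₁ - s) * (y₂ - m * x₂ - s)) * Cm +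
              ((2 * s) * (y₂ - m * x₂ - s) * (y₂ + m * x₂ + s)) * hc₁ + ((2 * s) * x₁ ^ 3) * hc₂
          rw [← cubeClass_mul hf₁ hf₂, key, cubeClass_mul_pow_three (neg_ne_zero.mpr h2s)
            (div_ne_zero (neg_ne_zero.mpr (mul_ne_zero hx₁ hx₂)) hμ)]
        · /- everything generic: `α(P) α(Q) = (−(Y + m x₃ + s)) (−μ/x₃)³` -/
          have hx₃ne : x₃ ≠ 0 := by
            intro h
            have h3 : (Y - m * x₃ - s) * (Y + m * x₃ + s) = 0 := by rw [hc₃, h]; ring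
            rcases mul_eq_zero.mp h3 with h' | h'
            · exact hfR h'
            · exact hgR h'
          have hμ : y₁ - s - ℓ * x₁ ≠ 0 := by
            intro h0
            rw [h0, zero_pow three_ne_zero, mul_eq_zero, mul_eq_zero] at Cp
            rcases Cp with (h | h) | h
            · exact hf₁ h
            · exact hf₂ h
            · exact hfR h
          have key : (y₁ - m * x₁ - s) * (y₂ - m * x₂ - s) =
              -(Y + m * x₃ + s) * (-(y₁ - s - ℓ * x₁) / x₃) ^ 3 := by
            rw [div_pow, mul_div_assoc', eq_div_iff (pow_ne_zero 3 hx₃ne)]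
            linear_combination (Y + m * x₃ + s) * Cp -
              (y₁ - m * x₁ - s) * (y₂ - m * x₂ - s) * hc₃
          rw [← cubeClass_mul hf₁ hf₂, key, cubeClass_mul_pow_three (neg_ne_zero.mpr hgR)
            (div_ne_zero (neg_ne_zero.mpr hμ) hx₃ne)]

/-- `[α(−P)] [α(P)] = 1`. [cite: CohenPazuki2009, Proposition 1.4 (2)] -/
theorem descentClass_neg_mul (hW : W = threeTorsionModel m s) (h2 : (2 : F) ≠ 0) (hs : s ≠ 0)
    (P : W.toAffine.Point) : descentClass W m s (-P) * descentClass W m s P = 1 := by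
  rw [← descentClass_add hW h2 hs, neg_add_cancel, descentClass_zero]

/-- Points with the same descent class differ by a point of trivial class:
`[α(P)] = [α(Q)] ⇒ [α(P − Q)] = 1`. [cite: CohenPazuki2009, Proposition 1.4 (2)] -/
theorem descentClass_sub_eq_one (hW : W = threeTorsionModel m s) (h2 : (2 : F) ≠ 0) (hs : s ≠ 0)
    {P Q : W.toAffine.Point} (h : descentClass W m s P = descentClass W m s Q) :
    descentClass W m s (P - Q) = 1 := by
  rw [sub_eq_add_neg, descentClass_add hW h2 hs, h, CubeUnits.mul_comm]
  exact descentClass_neg_mul hW h2 hs Q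

/-- `[α(T)] = [(2s)²]` for the `3`-torsion point `T = (0, s)`, i.e. the class of `1/(2s)`.
[cite: CohenPazuki2009, Definition 1.3 (α((0,b)) = 1/(2b))] -/
theorem descentClass_T_eq (hT : W.toAffine.Nonsingular 0 s) (h2s : (2 : F) * s ≠ 0) :
    descentClass W m s (.some 0 s hT) = cubeClass (1 / (2 * s)) := by
  rw [descentClass, descent_some_of_eq m s hT (by ring), cubeClass_sq_eq_cubeClass_inv h2s]

/-- `[α(−T)] = [−2s] = [2s]` for `−T = (0, −s)`. [cite: CohenPazuki2009, Definition 1.3] -/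
theorem descentClass_negT_eq (hT : W.toAffine.Nonsingular 0 (-s)) (h2s : (2 : F) * s ≠ 0) :
    descentClass W m s (.some 0 (-s) hT) = cubeClass (2 * s) := by
  rw [descentClass, descent_some_of_ne m s hT (by
    rw [mul_zero, sub_zero]; intro h; exact h2s (by linear_combination -h)),
    show -s - m * 0 - s = -(2 * s) by ring, cubeClass_neg]

variable (W) in
/-- **The `3`-descent homomorphism** `α : E(F) →+ Fˣ/Fˣ³` (written additively on the source,
`Additive` on the target), for `W = threeTorsionModel m s`, `2 ≠ 0`, `s ≠ 0`.
[cite: CohenPazuki2009, Proposition 1.4 (2)] -/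
def descentHom (hW : W = threeTorsionModel m s) (h2 : (2 : F) ≠ 0) (hs : s ≠ 0) :
    W.toAffine.Point →+ Additive (CubeUnits F) where
  toFun P := Additive.ofMul (descentClass W m s P)
  map_zero' := by rw [descentClass_zero]; rfl
  map_add' P Q := by rw [descentClass_add hW h2 hs]; rfl

/-- The descent homomorphism evaluates to the descent class. [cite: CohenPazuki2009, Proposition 1.4 (2)] -/
@[simp] theorem descentHom_apply (hW : W = threeTorsionModel m s) (h2 : (2 : F) ≠ 0) (hs : s ≠ 0)
    (P : W.toAffine.Point) : descentHom W hW h2 hs P = Additive.ofMul (descentClass W m s P) := rfl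

/-- `3 · [α(P)] = 0`: the image of `α` is killed by `3` (it lies in `Fˣ/Fˣ³ = G₃`). [cite: CohenPazuki2009, Definition 1.3 (G₃ ⊆ K*/K*³)] -/
theorem descentClass_pow_three (P : W.toAffine.Point) :
    descentClass W m s P * descentClass W m s P * descentClass W m s P = 1 :=
  CubeUnits.mul_mul_self _

/-- `[α(3 • P)] = 1`: triples of points have trivial descent class. [cite: CohenPazuki2009, Proposition 1.4 (1)–(2)] -/
theorem descentClass_three_nsmul (hW : W = threeTorsionModel m s) (h2 : (2 : F) ≠ 0) (hs : s ≠ 0)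
    (P : W.toAffine.Point) : descentClass W m s ((3 : ℕ) • P) = 1 := by
  rw [show (3 : ℕ) • P = P + P + P by rw [show (3 : ℕ) = 2 + 1 from rfl, succ_nsmul, two_nsmul],
    descentClass_add hW h2 hs,
    descentClass_add hW h2 hs]
  exact descentClass_pow_three P

end Descent

end ThreeTorsionDescent

end Literature.NumberTheory.EllipticCurves
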